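import Summits.ResolutionOfSingularities.ResolutionOfSingularities.Theorems.EquisingularLiftEquisingularLiftNatLargeCharSpreadCentres
import Literature.AlgebraicGeometry.Morphisms.GenericFlatness
import HarnessLib

/-!
# EL♮(3) / EL♮(n), RUNG LC «large characteristic» — brick (B3′)(s4)/(B3″)(t2): GENERIC FLATNESS, PACKAGED for the spread — a finite-type
# `A`-scheme (resp. a closed subscheme, resp. the trace of a divisor on a closed subscheme) is FLAT over every base `A → B` inverting some `a ≠ 0`

leafhand-res-equisingularlift-3 g0 (prover, 2026-08-31; one-generation line-first hand on stmt-ResolutionOfSingularities-20148 / -20038 /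
-15660, cell `pub/decomp-res`).  Crux `EquisingularLiftNatThree` (`stmt-…-20148`; uniform in `n`, so also `stmt-…-20038`), line W4.5(b), RUNG LC
(idea-2 g32 `Cruxes/EquisingularLiftNatThree/LARGE-CHAR-RUNG-idea2.md` v1.6 §(B3′)(s4) «`T_i → Spec A` FLAT … (GENERIC FLATNESS ✓ … = GW 10.83 / EGA IV
6.9.1, PROVED)», §(B3″)(t2) «generic flatness makes `T_i → Spec B` and `(T_i ∩ Exc_i) → Spec B` FLAT after shrinking»).  The fibre-side LC-FIB brick
✓ `comap_strictTransformIdeal_of_flat_trace` (…NatLargeCharFibreStrictTransformSat) needs exactly ONE spreading input: the trace `E ∩ V(𝓣')` of the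
exceptional divisor on the B-side strict transform is FLAT over the base.  The tree PROVES generic flatness at scheme level
(✓ `Literature.AlgebraicGeometry.Morphisms.exists_flat_morphismRestrict_basicOpen`, GW Thm. 10.84 / Cor. 10.85 over an integral locally Noetherian
base: `f ∣_ D(s)` flat for some `s ≠ 0`); this file PACKAGES it in the currency of the RUNG-LC spread (✓ `CentreSeq.exists_forall_descCentresSmoothOver_comap`:
«for every `A`-algebra `B` in which `a` is a unit and every cartesian square over `Spec B → Spec A`»), DEF-FREE:

* `exists_forall_flat_of_isPullback` — for `g : W → Spec A` of finite type over a Noetherian domain: `∃ a ≠ 0, ∀ B ∋ a⁻¹, ∀` cartesian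
  `W_B = W ×_A Spec B`, `W_B → Spec B` is FLAT (generic flatness over `D(a)`; `Spec B → Spec A` factors through `D(a)` (✓ `specMap_mem_basicOpen_of_isUnit`,
  Mathlib `IsOpenImmersion.lift`), so `W_B → Spec B` is a base change of the flat `g ∣_ D(a)` (Mathlib `isPullback_morphismRestrict`, `IsPullback.of_right'`));
* `exists_forall_flat_subschemeι_comap` — the same for a closed subscheme `V(I) ⊆ X` of an `A`-scheme of finite type: `V(ι_B^*I) → Spec B` flat
  (✓ `isPullback_subschemeMap_comap`);
* ★ `exists_forall_flat_trace_comap` — the same for the TRACE `V(P·𝒪_{V(I)})` of a second ideal `P` on `V(I)` (the shape `E ∩ V(𝓣')` of LC-FIB):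
  `∃ a ≠ 0, ∀ B ∋ a⁻¹, ∀` square, `Flat ((((P.comap ι_B).comap (I.comap ι_B).subschemeι)).subschemeι ≫ (I.comap ι_B).subschemeι ≫ q_B)` — literally the
  instance argument of ✓ `comap_strictTransformIdeal_of_flat_trace` for the base-changed word (two cartesian squares of closed subschemes,
  Mathlib `subschemeMap_subschemeι` / `comap_comp`).

WHAT REMAINS of `hspread` (honest, exact): the (B5) RECURSION threading the running ideal `𝓣ᵢ` (`𝓣₀ = 𝓗_A`, `𝓣ᵢ₊₁ = strictTransformIdeal πᵢ Cᵢ 𝓣ᵢ`) along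
the model tower with, at each stage, (ii) `𝓣ᵢ ≤ Cᵢ` over `D(a)` (K-side set-level E1 + regular centre ⇒ ideal-level; spread ✓ `exists_comap_ι_le_comap_ι_of_generic`;
S–M), this file's flatness of the trace (✓), ✓ LC-FIB, ✓ (f2), and at the end (iii) END smoothness (✓ `exists_forall_mem_smoothLocus_of_smooth_comap`) + ✓ (f4);
(iv) the position token (f3) by fibre dimension (M); then ✓ `descDoorAt_of_smoothCentres` + ✓ `descDoorAt_of_ringHom` + the N:=1 glue ⇒ `hspread`.
EL♮(3) NOT proved; EL♮ NOT proved; resolution of singularities in positive characteristic NOT proved; nothing of [Hironaka2017] (a candidate under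
adjudication) is asserted or used.  [OURS · EGA IV₂ 6.9.1 packaging over the tree's proved generic flatness · standard axioms · DEF-FREE ·
`--supports stmt-ResolutionOfSingularities-20148 --as helper`, counted 0 · AI-written, weaker than expert review.]
[cite: GortzWedhorn2020, Thm. 10.84, Cor. 10.85] [cite: EGAIV2, Thm. 6.9.1] (method; index only)
-/

set_option linter.dupNamespace false -- mandated namespace `Summit.<Summit>.<Problem>` of this single-conjunct summit

noncomputable section

open CategoryTheory CategoryTheory.Limits AlgebraicGeometry TopologicalSpace PrimeSpectrum
open Literature.AlgebraicGeometry.Resolution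
open AlgebraicGeometry.Scheme.IdealSheafData

namespace Summit.ResolutionOfSingularities.ResolutionOfSingularities.Cruxes.EquisingularLiftNat.Sections

section GenericFlatness

variable {A : Type} [CommRing A] [IsDomain A] [IsNoetherianRing A]

/-- **Generic flatness, packaged for the spread**: for `g : W → Spec A` of finite type over a Noetherian domain there is `a ≠ 0` such that for
every `A`-algebra `B` in which `a` is a unit and every cartesian square `W_B = W ×_{Spec A} Spec B`, the projection `W_B → Spec B` is FLAT.
Generic flatness (✓ `exists_flat_morphismRestrict_basicOpen`, GW 10.84) gives `s ≠ 0` with `g ∣_ D(s)` flat; `Spec B → Spec A` lands in `D(a)`,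
`a = s` read in `A` (Mathlib `basicOpen_eq_of_affine'`, ✓ `specMap_mem_basicOpen_of_isUnit`), hence factors through it (Mathlib `IsOpenImmersion.lift`),
and `W_B → Spec B` is the base change of `g ∣_ D(s)` along that factorisation (Mathlib `isPullback_morphismRestrict`, `IsPullback.of_right'`).
[cite: GortzWedhorn2020, Thm. 10.84, Cor. 10.85] [OURS · packaging] -/
theorem exists_forall_flat_of_isPullback {W : Scheme.{0}} (g : W ⟶ Spec (.of A)) [LocallyOfFiniteType g] [QuasiCompact g] :
    ∃ a : A, a ≠ 0 ∧ ∀ (B : Type) [CommRing B] [Algebra A B], IsUnit (algebraMap A B a) →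
      ∀ {WB : Scheme.{0}} (ι' : WB ⟶ W) (g' : WB ⟶ Spec (.of B)), IsPullback ι' g' g (specOfAlgebra A B) → Flat g' := by
  -- generic flatness over the (non-empty, affine) base `Spec A`
  have hV : IsAffineOpen (⊤ : (Spec (.of A)).Opens) := isAffineOpen_top _
  have hVne : ((⊤ : (Spec (.of A)).Opens) : Set (Spec (.of A))).Nonempty :=
    ⟨⟨⊥, Ideal.isPrime_bot⟩, trivial⟩
  obtain ⟨s, hs0, hflat⟩ := Literature.AlgebraicGeometry.Morphisms.exists_flat_morphismRestrict_basicOpen g hV hVne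
  -- read `s` in `A`
  set a : A := (Scheme.ΓSpecIso (.of A)).hom s with ha
  have ha0 : a ≠ 0 := by
    intro h
    apply hs0
    have : (Scheme.ΓSpecIso (.of A)).inv a = s := by rw [ha, Iso.hom_inv_id_apply]
    rw [← this, h, map_zero]
  have hU : ((Spec (.of A)).basicOpen s : Set (Spec (.of A))) = (basicOpen a : Set (PrimeSpectrum A)) := by
    rw [basicOpen_eq_of_affine', ha]
    rfl
  refine ⟨a, ha0, fun B _ _ hunit WB ι' g' HX => ?_⟩
  -- `Spec B → Spec A` factors through `D(a)`
  set U : (Spec (.of A)).Opens := (Spec (.of A)).basicOpen s with hUdef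
  have hrange : Set.range (specOfAlgebra A B) ⊆ Set.range U.ι := by
    rw [Scheme.Opens.range_ι, hU]
    rintro _ ⟨y, rfl⟩
    exact specMap_mem_basicOpen_of_isUnit B hunit y
  set h₂₁ : Spec (.of B) ⟶ U := IsOpenImmersion.lift U.ι (specOfAlgebra A B) hrange with hh
  have hfac : h₂₁ ≫ U.ι = specOfAlgebra A B := IsOpenImmersion.lift_fac _ _ hrange
  -- `W_B → Spec B` is the base change of the flat `g ∣_ U` along `h₂₁`
  have t : IsPullback (g ⁻¹ᵁ U).ι (g ∣_ U) g U.ι := (isPullback_morphismRestrict g U).flip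
  have HX' : IsPullback ι' g' g (h₂₁ ≫ U.ι) := by rw [hfac]; exact HX
  have hsq := IsPullback.of_right' HX' t
  haveI := hflat
  exact MorphismProperty.of_isPullback hsq hflat

variable (K : Type) [Field K] [Algebra A K]
  {X : Scheme.{0}} (q : X ⟶ Spec (.of A)) [LocallyOfFiniteType q] [QuasiCompact q]

omit [Algebra A K] in
/-- **Generic flatness for a closed subscheme, packaged**: for `V(I) ⊆ X` with `X → Spec A` of finite type over a Noetherian domain there is
`a ≠ 0` such that for every `A`-algebra `B ∋ a⁻¹` and every cartesian square `X_B = X ×_A Spec B` (`ι_B : X_B → X`), the pulled-back closed subscheme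
`V(ι_B^*I) → Spec B` is FLAT (`exists_forall_flat_of_isPullback` for `V(I) → Spec A`; the square of closed subschemes ✓ `isPullback_subschemeMap_comap`).
[cite: GortzWedhorn2020, Cor. 10.85] [OURS · packaging] -/
theorem exists_forall_flat_subschemeι_comap (I : X.IdealSheafData) :
    ∃ a : A, a ≠ 0 ∧ ∀ (B : Type) [CommRing B] [Algebra A B], IsUnit (algebraMap A B a) →
      ∀ {XB : Scheme.{0}} (ιB : XB ⟶ X) (qB : XB ⟶ Spec (.of B)), IsPullback ιB qB q (specOfAlgebra A B) →
        Flat ((I.comap ιB).subschemeι ≫ qB) := by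
  haveI : LocallyOfFiniteType (I.subschemeι ≫ q) := inferInstance
  haveI : QuasiCompact (I.subschemeι ≫ q) := inferInstance
  obtain ⟨a, ha, h⟩ := exists_forall_flat_of_isPullback (I.subschemeι ≫ q)
  refine ⟨a, ha, fun B _ _ hunit XB ιB qB HX => ?_⟩
  exact h B hunit _ _ (isPullback_subschemeMap_comap B q I HX)

omit [Algebra A K] in
/-- ★ **Generic flatness for the TRACE of a divisor on a closed subscheme, packaged** (the shape `E ∩ V(𝓣')` of LC-FIB): for ideal sheaves `I`, `P`
on an `A`-scheme `X → Spec A` of finite type over a Noetherian domain there is `a ≠ 0` such that for every `A`-algebra `B ∋ a⁻¹` and every cartesian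
square `X_B = X ×_A Spec B`, the trace `V((ι_B^*P)·𝒪_{V(ι_B^*I)}) → Spec B` is FLAT — literally the instance argument of
✓ `comap_strictTransformIdeal_of_flat_trace` for the base-changed word.  (`exists_forall_flat_of_isPullback` for the trace `V(P·𝒪_{V(I)}) → Spec A`; its
base change is the trace of the base change: two squares of closed subschemes ✓ `isPullback_subschemeMap_comap`, Mathlib `subschemeMap_subschemeι`.)
[cite: GortzWedhorn2020, Cor. 10.85] [OURS · L1 W4.5b · RUNG LC (B3″)(t2) packaging; EL♮(3) NOT proved] -/
theorem exists_forall_flat_trace_comap (I P : X.IdealSheafData) :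
    ∃ a : A, a ≠ 0 ∧ ∀ (B : Type) [CommRing B] [Algebra A B], IsUnit (algebraMap A B a) →
      ∀ {XB : Scheme.{0}} (ιB : XB ⟶ X) (qB : XB ⟶ Spec (.of B)), IsPullback ιB qB q (specOfAlgebra A B) →
        Flat ((((P.comap ιB).comap (I.comap ιB).subschemeι)).subschemeι ≫ (I.comap ιB).subschemeι ≫ qB) := by
  haveI : LocallyOfFiniteType (I.subschemeι ≫ q) := inferInstance
  haveI : QuasiCompact (I.subschemeι ≫ q) := inferInstance
  -- generic flatness for the trace `V(P·𝒪_{V(I)}) ⊆ V(I)` over `Spec A`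
  obtain ⟨a, ha, h⟩ := exists_forall_flat_subschemeι_comap (I.subschemeι ≫ q) (P.comap I.subschemeι)
  refine ⟨a, ha, fun B _ _ hunit XB ιB qB HX => ?_⟩
  -- the square of the closed subschemes `V(ι_B^*I) → V(I)`
  have hsq := isPullback_subschemeMap_comap B q I HX
  have hflat := h B hunit _ _ hsq
  -- the trace of the base change is the base change of the trace
  have hid : (P.comap I.subschemeι).comap (subschemeMap (I.comap ιB) I ιB (I.le_map_comap ιB)) =
      (P.comap ιB).comap (I.comap ιB).subschemeι := by
    rw [← comap_comp, subschemeMap_subschemeι, comap_comp]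
  rw [hid] at hflat
  exact hflat

end GenericFlatness

end Summit.ResolutionOfSingularities.ResolutionOfSingularities.Cruxes.EquisingularLiftNat.Sections

end
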